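/-
COR-CM (cell pub-hodgecm2, stage 2 of the Hodge ladder) — count-neutral KERNEL COMBINATORICS «census ↔ tree dictionary, part 7: the
cover check on a TRANSVERSAL of type blocks» (seat prover-pub-hodgecm2-b23-g33-0, binder prover b23, gen 33; claim INT2-INTRINSIC addendum
DEG12-GENERATORS; sequel of `CorCM/FaceCensusOrbitTransport.lean`).  Pure combinatorics; theorems only; no definition, no named fact,
nothing asserted.  HONEST FRAMING (COORDINATOR RULING — HODGE FRAMING CORRECTION, 2026-08-21T11:55:35Z): `HC_CM` is NOT proved, here or
anywhere in the tree.  T5: n/a-class (the hypotheses are the ordinary dictionary `(Γ, e)` and closed list data).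
-/
import Summits.HodgeConjecture.CorCM.FaceCensusOrbitTransport
import HarnessLib

/-!
# The cover side check of the orbit-equivariant transport on a transversal of type blocks

`FaceCensus.hgen_of_certOK_cover` (`CorCM/FaceCensusOrbitTransport.lean`) asks, as its hypothesis `hcover`, that the corner set of EVERY
face of the model be a Galois twist of the corner set of a certified face — `|faces| · n · |certs|` comparisons, 600 000 at degree 12,
more than the farm kernel's memory guard tolerates in one `decide`.  Reading a tree face at a DIFFERENT base embedding twists its type
code (`code_pullType_baseChange`) and the generating module is base-change invariant (`weightRel_mem_baseChange`), so it suffices to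
check the cover for faces whose type lies in a TRANSVERSAL `trans` of the twist-blocks of CM types (`htrans`: every CM type is carried
into `trans` by some twist; at degree 12: 6 types instead of 64, i.e. 180 faces instead of 1920).  This file proves the corresponding
transport `weightRel_mem_of_certOK_coverTrans` / `hgen_of_certOK_coverTrans`; the cover hypothesis is in kernel-economic LIST form
(precomputed twisted corner sets, seat b30's `genOrbitOK` economy).

References: [cite: Pohlmann1968, Thm. 1]; [cite: Milne1999LefschetzClasses, Thm. 3.2].
-/

noncomputable section

open NumberField NumberField.ComplexEmbedding
open scoped symmDiff

namespace Summit.HodgeConjecture.CorCM.FaceCensus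

open Literature.AlgebraicGeometry.Motives (CMType)
open Literature.NumberTheory.ComplexMultiplication.CMTypeOps
open Summit.HodgeConjecture.CorCM.Prior.AllgGroup.RfwfAllgGroup
open Summit.HodgeConjecture.CorCM.Census.FaceSquaresModel

variable {F : Type} [Field F] [NumberField F] [IsGalois ℚ F]
variable {n : ℕ} (Γ : CMGaloisType n) (e : GalT F ≃ Fin n)

/-- **THE ORBIT-EQUIVARIANT TRANSPORT with the cover checked on a transversal (pre-quotient form).**  As
`weightRel_mem_of_certOK_cover`, but the cover hypothesis is only asked for the faces of the model whose type lies in a list `trans`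
meeting every twist-block of CM types (`htrans`), and in list form (the twisted corner sets of the certified faces precomputed once).
[cite: Pohlmann1968, Thm. 1] -/
theorem weightRel_mem_of_certOK_coverTrans (hmul : ∀ P Q : GalT F, e (P * Q) = Γ.mul (e P) (e Q)) (hconj : e conjT = Γ.conj)
    (reps : List (ℕ × ℕ × ℕ)) (cs : List ((ℕ × ℕ × ℕ) × List ((ℕ × ℕ × ℕ) × ℤ) × List (ℕ × ℤ)))
    (hcs : (cs.all fun c => Γ.faces.contains c.1 && Γ.certOK reps c.1 c.2.1 c.2.2) = true)
    (trans : List ℕ) (htrans : (Γ.cmTypes.all fun T => (List.finRange n).any fun j => trans.contains (Γ.twist j T)) = true)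
    (hcover : (Γ.faces.all fun φ => !(trans.contains φ.1) || (cs.flatMap fun c => (List.finRange n).map fun j =>
        normalize (Γ.corners (Γ.twist j c.1.1, Γ.twist j c.1.2.1, Γ.twist j c.1.2.2))).contains (normalize (Γ.corners φ))) = true)
    (horb : (cs.all fun c => c.2.1.all fun gi => reps.any fun r => (List.finRange n).any fun j =>
      [(Γ.twist j r.1, Γ.twist j r.2.1, Γ.twist j r.2.2),
        (flipAt (Γ.twist j r.2.1) (Γ.twist j r.1), Γ.twist j r.2.1, Γ.twist j r.2.2),
        (flipAt (Γ.twist j r.2.2) (Γ.twist j r.1), Γ.twist j r.2.1, Γ.twist j r.2.2),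
        (flipAt (Γ.twist j r.2.2) (flipAt (Γ.twist j r.2.1) (Γ.twist j r.1)), Γ.twist j r.2.1, Γ.twist j r.2.2),
        (Γ.twist j r.1, Γ.twist j r.2.2, Γ.twist j r.2.1),
        (flipAt (Γ.twist j r.2.1) (Γ.twist j r.1), Γ.twist j r.2.2, Γ.twist j r.2.1),
        (flipAt (Γ.twist j r.2.2) (Γ.twist j r.1), Γ.twist j r.2.2, Γ.twist j r.2.1),
        (flipAt (Γ.twist j r.2.2) (flipAt (Γ.twist j r.2.1) (Γ.twist j r.1)), Γ.twist j r.2.2, Γ.twist j r.2.1)].contains gi.1)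
      = true)
    (hpc : (cs.all fun c => c.2.2.all fun pj => Γ.isCMType pj.1) = true)
    (σ₀ : F →+* ℂ) (𝒮 : Set (Face F))
    (hreps : ∀ r ∈ reps, ∃ R ∈ 𝒮, (r.1 < 2 ^ n ∧ ∀ i : Fin n, mem i r.1 = true ↔ e.symm i ∈ (pullType R.Φ σ₀).1) ∧
      Γ.placeMask (e (translate σ₀ R.p)) = r.2.1 ∧ Γ.placeMask (e (translate σ₀ R.p')) = r.2.2)
    (f : Face F) :
    weightRel f.corner (fun _ => ({σ₀} : Finset (F →+* ℂ))) ∈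
      Submodule.span ℤ {y : CMF (GalT F) conjT →₀ ℤ | ∃ g ∈ 𝒮, ∃ σ : F →+* ℂ,
        y = weightRel g.corner (fun _ => ({σ} : Finset (F →+* ℂ)))} ⊔ pairRel := by
  rw [List.all_eq_true] at hcover hcs hpc horb htrans
  -- the face `f` read at `σ₀`, and a twist `j` carrying its type code into the transversal
  obtain ⟨T, hT⟩ := exists_code e (pullType f.Φ σ₀)
  obtain ⟨j, -, hjt⟩ := List.any_eq_true.mp (htrans T (code_mem_cmTypes Γ e hmul hconj hT))
  -- read `f` at the base embedding `σ₁ = Q σ₀` with `e Q⁻¹ = j`: its code there is `(T·j, …)` with `T·j ∈ trans`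
  set Q : GalT F := (e.symm j)⁻¹ with hQ
  have hjQ : e Q⁻¹ = j := by rw [hQ, inv_inv, e.apply_symm_apply]
  have hT' : Γ.twist j T < 2 ^ n ∧ ∀ i : Fin n, mem i (Γ.twist j T) = true ↔ e.symm i ∈ (pullType f.Φ (Q.1 σ₀)).1 := by
    rw [← hjQ]; exact code_pullType_baseChange Γ e hmul f.Φ σ₀ Q hT
  have hφ := faceCode_mem_faces Γ e hmul hconj f (Q.1 σ₀) hT'
  have hc0 := hcover _ hφ
  rw [hjt, Bool.not_true, Bool.false_or, List.contains_iff_mem, List.mem_flatMap] at hc0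
  obtain ⟨c, hc, hj'⟩ := hc0
  rw [List.mem_map] at hj'
  obtain ⟨j', -, hnorm⟩ := hj'
  have hc' := hcs c hc
  rw [Bool.and_eq_true] at hc'
  obtain ⟨hcf, hOK⟩ := hc'
  -- a tree face `C` reading as the certified face `c.1` at `σ₀`
  obtain ⟨C, hCT, hCp, hCq⟩ := exists_face_reads Γ e hmul hconj σ₀ (List.contains_iff_mem.mp hcf)
  -- (1) `weightRel C {σ₀}` is certified, hence in the module
  have hgen : ∀ gi ∈ c.2.1, ∃ r ∈ reps, ∃ j : Fin n, gi.1 ∈ [(Γ.twist j r.1, Γ.twist j r.2.1, Γ.twist j r.2.2),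
      (flipAt (Γ.twist j r.2.1) (Γ.twist j r.1), Γ.twist j r.2.1, Γ.twist j r.2.2),
      (flipAt (Γ.twist j r.2.2) (Γ.twist j r.1), Γ.twist j r.2.1, Γ.twist j r.2.2),
      (flipAt (Γ.twist j r.2.2) (flipAt (Γ.twist j r.2.1) (Γ.twist j r.1)), Γ.twist j r.2.1, Γ.twist j r.2.2),
      (Γ.twist j r.1, Γ.twist j r.2.2, Γ.twist j r.2.1),
      (flipAt (Γ.twist j r.2.1) (Γ.twist j r.1), Γ.twist j r.2.2, Γ.twist j r.2.1),
      (flipAt (Γ.twist j r.2.2) (Γ.twist j r.1), Γ.twist j r.2.2, Γ.twist j r.2.1),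
      (flipAt (Γ.twist j r.2.2) (flipAt (Γ.twist j r.2.1) (Γ.twist j r.1)), Γ.twist j r.2.2, Γ.twist j r.2.1)] := by
    intro gi hgi
    have h := List.all_eq_true.mp (horb c hc) gi hgi
    obtain ⟨r, hr, h⟩ := List.any_eq_true.mp h
    obtain ⟨j'', -, h⟩ := List.any_eq_true.mp h
    exact ⟨r, hr, j'', List.contains_iff_mem.mp h⟩
  have hCmem : weightRel C.corner (fun _ => ({σ₀} : Finset (F →+* ℂ))) ∈
      Submodule.span ℤ {y : CMF (GalT F) conjT →₀ ℤ | ∃ g ∈ 𝒮, ∃ σ : F →+* ℂ,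
        y = weightRel g.corner (fun _ => ({σ} : Finset (F →+* ℂ)))} ⊔ pairRel := by
    unfold CMGaloisType.certOK at hOK
    rw [Bool.and_eq_true, List.all_eq_true, List.all_eq_true] at hOK
    refine mem_of_eval_eq_comboVal Γ e hmul hconj σ₀ 𝒮 reps hreps c.2.1 c.2.2 hgen (List.all_eq_true.mp (hpc c hc)) _
      fun Ψ S hS => ?_
    rw [weightRel_corner_apply Γ e hmul hconj C σ₀ hCT Ψ hS, hCp, hCq]
    exact beq_iff_eq.mp (hOK.2 S (code_mem_cmTypes Γ e hmul hconj hS))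
  -- (2) move `C` to the base embedding realising the twist by `g_{j'}`
  set Q' : GalT F := (e.symm j')⁻¹ with hQ'
  have hjQ' : e Q'⁻¹ = j' := by rw [hQ', inv_inv, e.apply_symm_apply]
  have hCT' : Γ.twist j' c.1.1 < 2 ^ n ∧ ∀ i : Fin n, mem i (Γ.twist j' c.1.1) = true ↔ e.symm i ∈ (pullType C.Φ (Q'.1 σ₀)).1 := by
    rw [← hjQ']; exact code_pullType_baseChange Γ e hmul C.Φ σ₀ Q' hCT
  have hCp' : Γ.placeMask (e (translate (Q'.1 σ₀) C.p)) = Γ.twist j' c.1.2.1 := by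
    rw [placeMask_translate_baseChange Γ e hmul, hjQ', hCp]
  have hCq' : Γ.placeMask (e (translate (Q'.1 σ₀) C.p')) = Γ.twist j' c.1.2.2 := by
    rw [placeMask_translate_baseChange Γ e hmul, hjQ', hCq]
  have hCmem' := weightRel_mem_baseChange 𝒮 C σ₀ (Q'.1 σ₀) hCmem
  -- (3) `f` at `Q σ₀` and `C` at `Q' σ₀` have the same corner set, hence the same corner indicator
  have heq : weightRel f.corner (fun _ => ({Q.1 σ₀} : Finset (F →+* ℂ))) =
      weightRel C.corner (fun _ => ({Q'.1 σ₀} : Finset (F →+* ℂ))) := by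
    ext Ψ
    obtain ⟨S, hS⟩ := exists_code e Ψ
    rw [weightRel_corner_apply Γ e hmul hconj f (Q.1 σ₀) hT' Ψ hS, weightRel_corner_apply Γ e hmul hconj C (Q'.1 σ₀) hCT' Ψ hS,
      hCp', hCq', contains_eq_of_normalize_eq hnorm.symm S]
  -- (4) back to `σ₀` by base-change invariance
  have hf' : weightRel f.corner (fun _ => ({Q.1 σ₀} : Finset (F →+* ℂ))) ∈
      Submodule.span ℤ {y : CMF (GalT F) conjT →₀ ℤ | ∃ g ∈ 𝒮, ∃ σ : F →+* ℂ,
        y = weightRel g.corner (fun _ => ({σ} : Finset (F →+* ℂ)))} ⊔ pairRel := by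
    rw [heq]; exact hCmem'
  exact weightRel_mem_baseChange 𝒮 f (Q.1 σ₀) σ₀ hf'

/-- **THE ORBIT-EQUIVARIANT TRANSPORT with the cover checked on a transversal.**  `hgen(𝒮, σ₀)` at every face of `F`.
[cite: Pohlmann1968, Thm. 1] [cite: Milne1999LefschetzClasses, Thm. 3.2] -/
theorem hgen_of_certOK_coverTrans (hmul : ∀ P Q : GalT F, e (P * Q) = Γ.mul (e P) (e Q)) (hconj : e conjT = Γ.conj)
    (reps : List (ℕ × ℕ × ℕ)) (cs : List ((ℕ × ℕ × ℕ) × List ((ℕ × ℕ × ℕ) × ℤ) × List (ℕ × ℤ)))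
    (hcs : (cs.all fun c => Γ.faces.contains c.1 && Γ.certOK reps c.1 c.2.1 c.2.2) = true)
    (trans : List ℕ) (htrans : (Γ.cmTypes.all fun T => (List.finRange n).any fun j => trans.contains (Γ.twist j T)) = true)
    (hcover : (Γ.faces.all fun φ => !(trans.contains φ.1) || (cs.flatMap fun c => (List.finRange n).map fun j =>
        normalize (Γ.corners (Γ.twist j c.1.1, Γ.twist j c.1.2.1, Γ.twist j c.1.2.2))).contains (normalize (Γ.corners φ))) = true)
    (horb : (cs.all fun c => c.2.1.all fun gi => reps.any fun r => (List.finRange n).any fun j =>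
      [(Γ.twist j r.1, Γ.twist j r.2.1, Γ.twist j r.2.2),
        (flipAt (Γ.twist j r.2.1) (Γ.twist j r.1), Γ.twist j r.2.1, Γ.twist j r.2.2),
        (flipAt (Γ.twist j r.2.2) (Γ.twist j r.1), Γ.twist j r.2.1, Γ.twist j r.2.2),
        (flipAt (Γ.twist j r.2.2) (flipAt (Γ.twist j r.2.1) (Γ.twist j r.1)), Γ.twist j r.2.1, Γ.twist j r.2.2),
        (Γ.twist j r.1, Γ.twist j r.2.2, Γ.twist j r.2.1),
        (flipAt (Γ.twist j r.2.1) (Γ.twist j r.1), Γ.twist j r.2.2, Γ.twist j r.2.1),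
        (flipAt (Γ.twist j r.2.2) (Γ.twist j r.1), Γ.twist j r.2.2, Γ.twist j r.2.1),
        (flipAt (Γ.twist j r.2.2) (flipAt (Γ.twist j r.2.1) (Γ.twist j r.1)), Γ.twist j r.2.2, Γ.twist j r.2.1)].contains gi.1)
      = true)
    (hpc : (cs.all fun c => c.2.2.all fun pj => Γ.isCMType pj.1) = true)
    (σ₀ : F →+* ℂ) (𝒮 : Set (Face F))
    (hreps : ∀ r ∈ reps, ∃ R ∈ 𝒮, (r.1 < 2 ^ n ∧ ∀ i : Fin n, mem i r.1 = true ↔ e.symm i ∈ (pullType R.Φ σ₀).1) ∧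
      Γ.placeMask (e (translate σ₀ R.p)) = r.2.1 ∧ Γ.placeMask (e (translate σ₀ R.p')) = r.2.2)
    (f : Face F) :
    lefChar f.corner (fun _ => ({σ₀} : Finset (F →+* ℂ))) ∈ AddSubgroup.closure
      {a : Asym F | ∃ g ∈ 𝒮, ∃ σ : F →+* ℂ, a = lefChar g.corner (fun _ => ({σ} : Finset (F →+* ℂ)))} :=
  hgen_of_weightRel_mem_span 𝒮 σ₀
    (weightRel_mem_of_certOK_coverTrans Γ e hmul hconj reps cs hcs trans htrans hcover horb hpc σ₀ 𝒮 hreps) f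

end Summit.HodgeConjecture.CorCM.FaceCensus

end
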